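import Literature.Geometry.Manifold.OpenSubmanifoldTangent
import Literature.Geometry.Lorentzian.PseudoRiemannianMetric
import HarnessLib

/-!
# Gluing fields of bilinear forms (and metrics) defined on an open cover

Topic `Literature/Geometry/Manifold` (namespace `Literature.Geometry.Manifold.OpenSubmanifold`).
The converse of the restriction lemma `OpenSubmanifold.contMDiff_bilinSection`
(`OpenSubmanifoldTangent.lean`: smooth fields of bilinear forms on `X` restrict to smooth fields
on an open submanifold `U`): smoothness of a field of bilinear forms on the tangent spaces is a
LOCAL property which can be tested on the open submanifolds of a cover, because the tangent
bundle `TU` has the trivialisations of `TX` (`continuousLinearMapAt_trivializationAt_eq`,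
`trivializationAt_symm_apply_eq`). Hence locally defined, compatible fields glue — the sheaf
property of tensor fields (O'Neill 1983, Ch. 2, pp. 36–37: a tensor field is determined by, and
can be defined through, its restrictions to the open sets of a cover):

* `contMDiffAt_bilinSection_of_restrict` — if `x₀ ∈ U` and the restriction of `s` to the open
  submanifold `U` is `C^n` at `x₀` (as a section of `Hom(TU, Hom(TU, ℝ))`), then `s` is `C^n` at
  `x₀` (as a section of `Hom(TX, Hom(TX, ℝ))`);
* `contMDiff_bilinSection_of_openCover` — a field whose restrictions to the members of an open
  cover are `C^n` is `C^n`;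
* `exists_pseudoRiemannianMetric_of_openCover` — pseudo-Riemannian metrics `g i` on the open
  submanifolds `U i` of a cover of `X` which agree on overlaps are the restrictions of a (unique)
  pseudo-Riemannian metric on `X`.

Use: final assembly (layer L7) of the metric on a glued manifold `P = M ∪_φ N` from its three
open pieces `P ∖ jN(N)`, `P ∖ jM(M)` and a collar of the seam, in the proof programme of
`Literature.Geometry.Riemannian.BaerHankePscGluing` (Bär–Hanke, §4.4, Thm. 42).

Everything is proved; no definitions and no named facts are introduced.

## References

* B. O'Neill, *Semi-Riemannian Geometry with Applications to Relativity*, Academic Press 1983,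
  Ch. 2, pp. 36–37 (tensor fields and open sets), Ch. 3, Def. 3.1 (metric tensors); the same
  locus as `OpenSubmanifoldTangent.lean`. [ONeillSemiRiemannian1983]
-/

noncomputable section

open Bundle Set Filter Function TopologicalSpace
open scoped Manifold ContDiff Topology

namespace Literature.Geometry.Manifold

namespace OpenSubmanifold

variable {E : Type*} [NormedAddCommGroup E] [NormedSpace ℝ E] {H : Type*} [TopologicalSpace H]
  {I : ModelWithCorners ℝ E H} {X : Type*} [TopologicalSpace X] [ChartedSpace H X]
  [IsManifold I ∞ X]

/-- **Smoothness of a field of bilinear forms is local on open submanifolds** (converse of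
`contMDiff_bilinSection`, pointwise): if `x₀ ∈ U` and `x ↦ s ↑x` is `C^n` at `x₀` as a section
of `Hom(TU, Hom(TU, ℝ))` over the open submanifold `U`, then `s` is `C^n` at `x₀` as a section of
`Hom(TX, Hom(TX, ℝ))`: the trivialised expressions agree near `x₀` (the trivialisations of `TU`
are those of `TX`) and `ContMDiffAt` on `U` versus `X` is `contMDiffAt_subtype_iff`.
O'Neill 1983, Ch. 2, pp. 36–37. [cite: ONeillSemiRiemannian1983, Ch. 2, pp. 36–37] -/
theorem contMDiffAt_bilinSection_of_restrict {n : ℕ∞ω}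
    {s : Π x : X, TangentSpace I x →L[ℝ] TangentSpace I x →L[ℝ] ℝ} (U : Opens X) (x₀ : U)
    (hs : ContMDiffAt I (I.prod 𝓘(ℝ, E →L[ℝ] E →L[ℝ] ℝ)) n
      (fun x : U ↦ TotalSpace.mk' (E →L[ℝ] E →L[ℝ] ℝ)
        (E := fun y : U ↦ TangentSpace I y →L[ℝ] TangentSpace I y →L[ℝ] ℝ) x (s x.1)) x₀) :
    ContMDiffAt I (I.prod 𝓘(ℝ, E →L[ℝ] E →L[ℝ] ℝ)) n
      (fun x : X ↦ TotalSpace.mk' (E →L[ℝ] E →L[ℝ] ℝ)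
        (E := fun y : X ↦ TangentSpace I y →L[ℝ] TangentSpace I y →L[ℝ] ℝ) x (s x)) x₀.1 := by
  rw [contMDiffAt_hom_bundle] at hs ⊢
  obtain ⟨-, hU⟩ := hs
  refine ⟨contMDiffAt_id, ?_⟩
  rw [← contMDiffAt_subtype_iff (U := U)]
  refine hU.congr_of_eventuallyEq ?_
  have hnhds : ∀ᶠ x : U in 𝓝 x₀, x.1 ∈ (chartAt H x₀.1).source :=
    continuous_subtype_val.continuousAt.preimage_mem_nhds
      ((chartAt H x₀.1).open_source.mem_nhds (mem_chart_source H x₀.1))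
  filter_upwards [hnhds] with x hx
  have hxU : x ∈ (trivializationAt E (TangentSpace I : U → Type _) x₀).baseSet := by
    simpa only [TangentBundle.trivializationAt_baseSet, Opens.chartAt_eq,
      OpenPartialHomeomorph.subtypeRestr_source, mem_preimage] using hx
  have hxX : x.1 ∈ (trivializationAt E (TangentSpace I : X → Type _) x₀.1).baseSet := by
    simpa only [TangentBundle.trivializationAt_baseSet] using hx
  ext v w
  rw [inCoordinates_apply_eq₂ hxX hxX (Set.mem_univ _),
    inCoordinates_apply_eq₂ hxU hxU (Set.mem_univ _)]
  simp only [Trivial.fiberBundle_trivializationAt', Trivial.linearMapAt_trivialization,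
    LinearMap.id_coe, id_eq, trivializationAt_symm_apply_eq hx]
  rfl

/-- **A field of bilinear forms is smooth if its restrictions to an open cover are**: for open
submanifolds `U i` covering `X`, if each restriction `x ↦ s ↑x` (`x : U i`) is a `C^n` section of
`Hom(T(U i), Hom(T(U i), ℝ))`, then `s` is a `C^n` section of `Hom(TX, Hom(TX, ℝ))`.
O'Neill 1983, Ch. 2, pp. 36–37. [cite: ONeillSemiRiemannian1983, Ch. 2, pp. 36–37] -/
theorem contMDiff_bilinSection_of_openCover {n : ℕ∞ω} {ι : Type*} (U : ι → Opens X)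
    (hcover : ∀ x : X, ∃ i, x ∈ U i)
    {s : Π x : X, TangentSpace I x →L[ℝ] TangentSpace I x →L[ℝ] ℝ}
    (hs : ∀ i, ContMDiff I (I.prod 𝓘(ℝ, E →L[ℝ] E →L[ℝ] ℝ)) n
      (fun x : U i ↦ TotalSpace.mk' (E →L[ℝ] E →L[ℝ] ℝ)
        (E := fun y : U i ↦ TangentSpace I y →L[ℝ] TangentSpace I y →L[ℝ] ℝ) x (s x.1))) :
    ContMDiff I (I.prod 𝓘(ℝ, E →L[ℝ] E →L[ℝ] ℝ)) n
      (fun x : X ↦ TotalSpace.mk' (E →L[ℝ] E →L[ℝ] ℝ)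
        (E := fun y : X ↦ TangentSpace I y →L[ℝ] TangentSpace I y →L[ℝ] ℝ) x (s x)) := by
  intro x₀
  obtain ⟨i, hi⟩ := hcover x₀
  exact contMDiffAt_bilinSection_of_restrict (U i) ⟨x₀, hi⟩ (hs i ⟨x₀, hi⟩)

open Literature.Geometry.Lorentzian in
/-- **Gluing pseudo-Riemannian metrics defined on an open cover.** Let `U i` be open
submanifolds covering `X` and `g i` a `C^n` pseudo-Riemannian metric on `U i` (a
`PseudoRiemannianMetric` on the tangent bundle of the open submanifold; recall
`T_x(U i) = T_x X` definitionally) such that `g i` and `g j` agree at every point of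
`U i ∩ U j`. Then there is a `C^n` pseudo-Riemannian metric `g` on `X` whose restriction to each
`U i` is `g i`. (Uniqueness is clear from the pointwise condition.) O'Neill 1983, Ch. 2,
pp. 36–37 and Ch. 3, Def. 3.1. [cite: ONeillSemiRiemannian1983, Ch. 2, pp. 36–37] -/
theorem exists_pseudoRiemannianMetric_of_openCover {n : ℕ∞ω} {ι : Type*} (U : ι → Opens X)
    (hcover : ∀ x : X, ∃ i, x ∈ U i)
    (g : ∀ i, PseudoRiemannianMetric I n E (TangentSpace I : U i → Type _))
    (hcompat : ∀ i j (x : X) (hi : x ∈ U i) (hj : x ∈ U j),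
      ((g i).val ⟨x, hi⟩ : E →L[ℝ] E →L[ℝ] ℝ) = (g j).val ⟨x, hj⟩) :
    ∃ gX : PseudoRiemannianMetric I n E (TangentSpace I : X → Type _),
      ∀ i (x : U i), (gX.val x.1 : E →L[ℝ] E →L[ℝ] ℝ) = (g i).val x := by
  classical
  -- a choice of index at every point
  set idx : X → ι := fun x ↦ Classical.choose (hcover x) with hidx
  have hmem : ∀ x, x ∈ U (idx x) := fun x ↦ Classical.choose_spec (hcover x)
  set val : Π x : X, TangentSpace I x →L[ℝ] TangentSpace I x →L[ℝ] ℝ :=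
    fun x ↦ (g (idx x)).val ⟨x, hmem x⟩ with hval
  have hrestrict : ∀ i (x : U i), (val x.1 : E →L[ℝ] E →L[ℝ] ℝ) = (g i).val x := fun i x ↦ by
    simp only [hval]
    exact hcompat (idx x.1) i x.1 (hmem x.1) x.2
  refine ⟨{ val := val
            symm := fun x v w ↦ (g (idx x)).symm ⟨x, hmem x⟩ v w
            nondegenerate := fun x v hv ↦ (g (idx x)).nondegenerate ⟨x, hmem x⟩ v hv
            contMDiff := ?_ }, hrestrict⟩
  refine contMDiff_bilinSection_of_openCover U hcover fun i ↦ ?_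
  have hfun : (fun x : U i ↦ TotalSpace.mk' (E →L[ℝ] E →L[ℝ] ℝ)
      (E := fun y : U i ↦ TangentSpace I y →L[ℝ] TangentSpace I y →L[ℝ] ℝ) x (val x.1)) =
      fun x : U i ↦ TotalSpace.mk' (E →L[ℝ] E →L[ℝ] ℝ)
        (E := fun y : U i ↦ TangentSpace I y →L[ℝ] TangentSpace I y →L[ℝ] ℝ) x ((g i).val x) := by
    funext x
    rw [hrestrict i x]
  rw [hfun]
  exact (g i).contMDiff

end OpenSubmanifold

end Literature.Geometry.Manifold

end
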